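import Summits.RiemannHypothesis.RiemannHypothesis.Theses.GroundBarta
import Summits.RiemannHypothesis.RiemannHypothesis.Theorems.WeilGroundStateGroundStatesConvergeToXiWeakLimitHarmonic
import Summits.RiemannHypothesis.RiemannHypothesis.Theorems.WeilGroundStateGroundStatesConvergeToXiExpClassHarmonic
import Summits.RiemannHypothesis.RiemannHypothesis.Theorems.WeilGroundStateGroundStatesConvergeToXiStubStrongClassPairing
import Summits.RiemannHypothesis.RiemannHypothesis.Theorems.WeilGroundStateGroundStatesConvergeToXiStubPhiIteratedDerivEnvelope
import Literature.NumberTheory.LFunctions.WeilGroundState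
import Literature.NumberTheory.LFunctions.WeilGroundEnergyProofs
import Literature.NumberTheory.LFunctions.WeilGroundStateRealZerosProofs
import Literature.NumberTheory.LFunctions.WeilGroundEnergyParitySplit
import Literature.NumberTheory.LFunctions.WeilWindowSuzukiContinuityProofs
import Literature.NumberTheory.LFunctions.WeilOddThetaVector
import Literature.NumberTheory.LFunctions.WeilThetaPhiMellin
import Literature.NumberTheory.LFunctions.WeilMarkovQuadratic
import Literature.NumberTheory.LFunctions.DeBruijnPhiDecreasing
import Literature.Analysis.Calculus.SmoothCutoff

/-!
# Crux `GroundBarta.GroundBartaFloor` (stmt-RiemannHypothesis-18389) — line `Sketch`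
(idea `outer-cutoff-harmonic-pairing`): Barta WITHOUT a window image

Lead prover's skeleton (`prover-line-stmt-RiemannHypothesis-18389-0`).  The one-signed bottom state
`u` of the window `[-a, a]` is paired with the OUTER smooth cut-off `k_η = Φ·χ_η` of Riemann's kernel
`Φ = weilThetaPhi` (`Φ̂ = ξ`), `χ_η = 1` on `[-a, a]`, `supp χ_η ⊆ [-a-η, a+η]`, `0 ≤ χ_η ≤ 1`, even.

* HARMONIC SPLITTING (`stub_harmonicSplit`).  `Φ` is Weil-harmonic (`phi_conv_harmonic`, in tree),
  so for every test `g`: `W(g ⋆ k̃_η) = -W(g ⋆ κ̃_η)` EXACTLY, `κ_η = Φ(1 - χ_η) ≥ 0` the leakage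
  kernel (exponential Weil class, `stub_leakageKernelEnvelope`).
* LIMIT ALONG THE MINIMISING SEQUENCE (`stub_leakageTendsto`).  `W(gₙ ⋆ κ̃_η) → W(u ⋆ κ̃_η)`
  (dominated convergence on the exponential class, in tree: `tendsto_weilFunctional_of_dominated`).
* LEAKAGE SIGN (`stub_leakageSign`).  For the non-negative real representative `v` of `u`,
  `f = v ⋆ κ̃_η ≥ 0` has `f(0) = 0` (disjoint supports), so `prime(f) ≥ 0`, Bombieri's
  `W_∞(f) ≤ 0`, `polar(f) = 2 c(v) c(κ_η) ≤ 2 c(v) ϖ_a`: `Re W(v ⋆ κ̃_η) ≤ 2 c(v) ϖ_a`,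
  `c(v) = ∫ v cosh(t/2)`, `ϖ_a = ∫_{|s|>a} Φ cosh(s/2)`.
* CAUCHY–SCHWARZ AT THE LARGER WINDOW `b = a + η` (proved here, `abs_polar_le`):
  `ε(b) Re⟨gₙ, k_η⟩ ≥ Re W(gₙ ⋆ k̃_η) - √(Re Q(gₙ) - ε(b)) √(q_b(k_η))`, and
  `q_b(k_η) ≤ C'` uniformly in `η ∈ (0, 1]` (`stub_cutoffEnergyBound`).
* `n → ∞`, then `η → 0⁺` through `continuousAt_weilGroundEnergy` (RH-free, in tree):
  `ε(a) ∫ v Φ ≥ -2 c(v) ϖ_a`, and `Φ(a) c(v) ≤ cosh(a/2) ∫ v Φ`, `∫ v Φ > 0` give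
  `ε(a) ≥ -e(a)`, `e(a) = 2 ϖ_a cosh(a/2) / Φ(a) → 0` (`stub_bartaRateDecay`).

Registered stubs: `stub_leakageKernelEnvelope`, `stub_harmonicSplit`, `stub_leakageTendsto`,
`stub_leakageSign`, `stub_cutoffEnergyBound`, `stub_bartaRateDecay`; everything else, including the
composition `GroundBartaFloor_of` concluding the crux BY NAME, is proved in this file.  Stub
signatures mention only importable vocabulary (Literature + Mathlib), no line-local definition.
-/

set_option linter.dupNamespace false

noncomputable section

open Set MeasureTheory Filter Complex
open scoped Real Topology ComplexConjugate

namespace Summit.RiemannHypothesis.RiemannHypothesis.Cruxes.GroundBartaFloor.OuterCutoff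

open Literature.NumberTheory.LFunctions
open Summit.RiemannHypothesis.RiemannHypothesis.Theorems.GroundStatesConvergeToXi

/-! ## The registered stubs -/

/-- **stub E — the leakage kernel lies in the exponential Weil class.**  For a smooth compactly
supported real cut-off `χ`, `κ = Φ(1 - χ)` is smooth and every derivative is `O(e^{-|t|})`
(Leibniz with `stub_phi_iteratedDeriv_envelope`; `Φ = weilThetaPhi = 2Ψ(2·)`, bridge
`weilThetaPhi_eq_two_mul_Psi`, `LagariasMontague.Psic`). -/
theorem stub_leakageKernelEnvelope :
    ∀ χ : ℝ → ℝ, ContDiff ℝ (⊤ : ℕ∞) χ → HasCompactSupport χ →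
      ContDiff ℝ (⊤ : ℕ∞) (fun t : ℝ => ((weilThetaPhi t * (1 - χ t) : ℝ) : ℂ)) ∧
      ∀ k : ℕ, ∃ C : ℝ, ∀ t : ℝ,
        ‖iteratedDeriv k (fun t : ℝ => ((weilThetaPhi t * (1 - χ t) : ℝ) : ℂ)) t‖ ≤
          C * Real.exp (-(1 * |t|)) := by
  sorry

/-- **stub H — harmonic splitting.**  For a Weil test `g` and `κ` in the exponential class,
`W(g ⋆ (Φ - κ)~) = -W(g ⋆ κ̃)`: `W(g ⋆ Φ̃) = conj W(Φ ⋆ g̃) = 0` (`phi_conv_harmonic`,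
`weilFunctional_weilConv_weilReflect_swap`) and `W` is additive on the exponential class
(`stub_strongClass_pairing`, `explicit_formula_expClass`). -/
theorem stub_harmonicSplit :
    ∀ (g κ : ℝ → ℂ), IsWeilTest g → ContDiff ℝ (⊤ : ℕ∞) κ →
      (∀ k : ℕ, ∃ C : ℝ, ∀ t : ℝ, ‖iteratedDeriv k κ t‖ ≤ C * Real.exp (-(1 * |t|))) →
      weilFunctional (weilConv g (weilReflect fun t => ((weilThetaPhi t : ℝ) : ℂ) - κ t)) =
        -weilFunctional (weilConv g (weilReflect κ)) := by
  sorry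

/-- **stub L — the leakage functional passes to the limit along the minimising sequence.**
`W(gₙ ⋆ κ̃) → W(u ⋆ κ̃)` for `κ` in the exponential class (`tendsto_weilFunctional_of_dominated`
with the uniform envelopes of `scPair_norm_weilConv_le` / `scPair_iteratedDeriv_eq` and
`tendsto_integral_norm_mul_exp_of_minimizingSeq`; pointwise convergence by the `L²` pairing with the
translates `κ(· - x)`). -/
theorem stub_leakageTendsto :
    ∀ (a : ℝ) (u : ℝ → ℂ) (g : ℕ → ℝ → ℂ) (κ : ℝ → ℂ), IsWeilGroundState a u →
      (∀ n, IsWeilTest (g n) ∧ tsupport (g n) ⊆ Icc (-a) a ∧ ∫ t, ‖g n t‖ ^ 2 = (1 : ℝ)) →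
      Tendsto (fun n => ∫ t, ‖g n t - u t‖ ^ 2) atTop (𝓝 0) →
      ContDiff ℝ (⊤ : ℕ∞) κ →
      (∀ k : ℕ, ∃ C : ℝ, ∀ t : ℝ, ‖iteratedDeriv k κ t‖ ≤ C * Real.exp (-(1 * |t|))) →
      Tendsto (fun n => weilFunctional (weilConv (g n) (weilReflect κ))) atTop
        (𝓝 (weilFunctional (weilConv u (weilReflect κ)))) := by
  sorry

/-- **stub S — the leakage sign lemma.**  For a non-negative integrable real `v` vanishing off
`[-a, a]` and a cut-off `χ` with `χ = 1` on `[-a, a]`, `0 ≤ χ ≤ 1`, `χ` even, and the leakage kernel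
`κ = Φ(1 - χ)` in the exponential class: `Re W(v ⋆ κ̃) ≤ 2 (∫ v cosh(t/2)) ϖ_a`,
`ϖ_a = ∫_{s>a} Φ(s) 2cosh(s/2) ds` — `f = v ⋆ κ̃ ≥ 0`, `f(0) = 0`, prime term `≥ 0`, Bombieri
archimedean term `≤ 0` (`weilArchTermBombieri_eq_weilArchTerm_expClass`), polar term
`2 c(κ) ∫ v cosh(t/2)` with `c(κ) = ∫ κ cosh(t/2) ≤ ϖ_a`. -/
theorem stub_leakageSign :
    ∀ (a : ℝ) (v : ℝ → ℝ) (χ : ℝ → ℝ), 0 < a → Integrable v → (∀ t, 0 ≤ v t) →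
      (∀ t, t ∉ Icc (-a) a → v t = 0) →
      (∀ t ∈ Icc (-a) a, χ t = 1) → (∀ t, 0 ≤ χ t ∧ χ t ≤ 1) → (∀ t, χ (-t) = χ t) →
      ContDiff ℝ (⊤ : ℕ∞) (fun t : ℝ => ((weilThetaPhi t * (1 - χ t) : ℝ) : ℂ)) →
      (∀ k : ℕ, ∃ C : ℝ, ∀ t : ℝ,
        ‖iteratedDeriv k (fun t : ℝ => ((weilThetaPhi t * (1 - χ t) : ℝ) : ℂ)) t‖ ≤
          C * Real.exp (-(1 * |t|))) →
      (weilFunctional (weilConv (fun t => ((v t : ℝ) : ℂ))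
          (weilReflect fun t => ((weilThetaPhi t * (1 - χ t) : ℝ) : ℂ)))).re ≤
        2 * (∫ t, v t * Real.cosh (t / 2)) *
          ∫ s in Ioi a, weilThetaPhi s * (2 * Real.cosh (s / 2)) := by
  sorry

/-- **stub C — uniform energy bound for the outer cut-offs.**  With
`χ_η = cutoff (a/η + 1) (·/η)` (`= 1` on `[-a,a]`, supported in `[-a-η, a+η]`),
`sup_{0<η≤1} Re Q(Φ χ_η) < ∞`: closed form `Re Q = P + 𝓔_{a+1} - M_{a+1}‖·‖²`
(`weilQuadratic_re_eq_weilPoleForm_add_weilDirichletEnergy_sub`) and the increment estimate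
`D_t(Φχ_η) ≤ 2 D_t(Φ) + 2Φ(0)² · 2(η + 2|t|) · min(1, D|t|/η)² ≤ C|t|` on `(0, 1]`. -/
theorem stub_cutoffEnergyBound :
    ∀ a : ℝ, 0 < a → ∃ C : ℝ, ∀ η : ℝ, 0 < η → η ≤ 1 →
      (weilQuadratic (fun t : ℝ =>
        ((weilThetaPhi t * Literature.Analysis.Calculus.cutoff (a / η + 1) (t / η) : ℝ) : ℂ))).re ≤
        C := by
  sorry

/-- **stub D — decay of the Barta rate** `e(a) = 2 ϖ_a cosh(a/2) / Φ(a) → 0`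
(termwise theta ratio bound, template `OddBartaFloor.stub_phiRatio`). -/
theorem stub_bartaRateDecay :
    Tendsto (fun a : ℝ => 2 * (∫ s in Ioi a, weilThetaPhi s * (2 * Real.cosh (s / 2))) *
      Real.cosh (a / 2) / weilThetaPhi a) atTop (𝓝 0) := by
  sorry

/-! ## The objects of the line -/

/-- The polar weight `ϖ_a = ∫_{s>a} Φ(s) · 2cosh(s/2) ds = ∫_{|s|>a} Φ cosh(s/2)`. -/
def polarWeight (a : ℝ) : ℝ :=
  ∫ s in Ioi a, weilThetaPhi s * (2 * Real.cosh (s / 2))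

/-- The Barta rate `e(a) = 2 ϖ_a cosh(a/2) / Φ(a)`. -/
def bartaRate (a : ℝ) : ℝ :=
  2 * polarWeight a * Real.cosh (a / 2) / weilThetaPhi a

/-- The outer cut-off `χ_η(x) = cutoff (a/η + 1) (x/η)`. -/
def cutoffFn (a η : ℝ) (x : ℝ) : ℝ :=
  Literature.Analysis.Calculus.cutoff (a / η + 1) (x / η)

/-- The probe `k_η = Φ χ_η` (a test function on the window `a + η`). -/
def probe (a η : ℝ) (t : ℝ) : ℂ :=
  ((weilThetaPhi t * cutoffFn a η t : ℝ) : ℂ)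

/-- The leakage kernel `κ_η = Φ (1 - χ_η)`. -/
def leak (a η : ℝ) (t : ℝ) : ℂ :=
  ((weilThetaPhi t * (1 - cutoffFn a η t) : ℝ) : ℂ)

theorem polarWeight_nonneg (a : ℝ) : 0 ≤ polarWeight a :=
  setIntegral_nonneg measurableSet_Ioi fun s _ =>
    mul_nonneg (weilThetaPhi_pos s).le (mul_nonneg zero_le_two (Real.cosh_pos _).le)

theorem bartaRate_nonneg (a : ℝ) : 0 ≤ bartaRate a :=
  div_nonneg (mul_nonneg (mul_nonneg zero_le_two (polarWeight_nonneg a)) (Real.cosh_pos _).le)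
    (weilThetaPhi_pos a).le

/-! ## The cut-off -/

section Cutoff

open Literature.Analysis.Calculus

variable {a η : ℝ}

theorem cutoffFn_eq_one (hη : 0 < η) {x : ℝ} (hx : x ∈ Icc (-a) a) : cutoffFn a η x = 1 := by
  unfold cutoffFn
  apply cutoff_eq_one
  rw [add_sub_cancel_right, abs_div, abs_of_pos hη, div_le_div_iff_of_pos_right hη]
  exact abs_le.2 ⟨hx.1, hx.2⟩

theorem cutoffFn_eq_zero (hη : 0 < η) {x : ℝ} (hx : a + η ≤ |x|) : cutoffFn a η x = 0 := by
  unfold cutoffFn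
  apply cutoff_eq_zero
  rw [abs_div, abs_of_pos hη, le_div_iff₀ hη, add_mul, div_mul_cancel₀ _ hη.ne', one_mul]
  exact hx

theorem cutoffFn_nonneg (x : ℝ) : 0 ≤ cutoffFn a η x := cutoff_nonneg _ _

theorem cutoffFn_le_one (x : ℝ) : cutoffFn a η x ≤ 1 := cutoff_le_one _ _

theorem cutoffFn_neg (x : ℝ) : cutoffFn a η (-x) = cutoffFn a η x := by
  unfold cutoffFn cutoff
  rw [neg_div, mul_comm]
  congr 1 <;> ring_nf

theorem contDiff_cutoffFn : ContDiff ℝ (⊤ : ℕ∞) (cutoffFn a η) :=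
  (contDiff_cutoff _).comp (contDiff_id.div_const η)

theorem cutoffFn_eq_zero_of_not_mem (hη : 0 < η) {x : ℝ} (hx : x ∉ Ioo (-(a + η)) (a + η)) :
    cutoffFn a η x = 0 := by
  apply cutoffFn_eq_zero hη
  simp only [mem_Ioo, not_and_or, not_lt] at hx
  rcases hx with h | h
  · exact (by linarith : a + η ≤ -x).trans (neg_le_abs x)
  · exact h.trans (le_abs_self x)

theorem tsupport_cutoffFn_subset (hη : 0 < η) :
    tsupport (cutoffFn a η) ⊆ Icc (-(a + η)) (a + η) := by
  refine closure_minimal (fun x hx => ?_) isClosed_Icc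
  by_contra h
  exact hx (cutoffFn_eq_zero_of_not_mem hη fun h' => h (Ioo_subset_Icc_self h'))

theorem hasCompactSupport_cutoffFn (hη : 0 < η) : HasCompactSupport (cutoffFn a η) :=
  HasCompactSupport.of_support_subset_isCompact isCompact_Icc
    ((subset_tsupport _).trans (tsupport_cutoffFn_subset hη))

end Cutoff

/-! ## Riemann's kernel: complex spelling and smoothness -/

theorem ofReal_weilThetaPhi_eq :
    (fun t : ℝ => ((weilThetaPhi t : ℝ) : ℂ)) = fun t : ℝ => (2 : ℂ) * LagariasMontague.Psic (2 * t) := by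
  funext t
  rw [weilThetaPhi_eq_two_mul_Psi]
  simp [LagariasMontague.Psic]

theorem contDiff_ofReal_weilThetaPhi : ContDiff ℝ (⊤ : ℕ∞) (fun t : ℝ => ((weilThetaPhi t : ℝ) : ℂ)) := by
  rw [ofReal_weilThetaPhi_eq]
  simpa using phiTr_contDiff 0

/-- `Φ(a) ≤ Φ(t)` for `|t| ≤ a` (`Φ` even and decreasing on `[0, ∞)`). -/
theorem weilThetaPhi_le_of_abs_le {a t : ℝ} (h : |t| ≤ a) : weilThetaPhi a ≤ weilThetaPhi t := by
  have ht : weilThetaPhi t = weilThetaPhi |t| := by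
    rcases le_or_gt 0 t with h0 | h0
    · rw [abs_of_nonneg h0]
    · rw [abs_of_neg h0, weilThetaPhi_neg]
  rw [ht]
  exact strictAntiOn_weilThetaPhi.antitoneOn (show |t| ∈ Ici (0 : ℝ) from abs_nonneg t)
    (show a ∈ Ici (0 : ℝ) from (abs_nonneg t).trans h) h

theorem weilThetaPhi_le_zero_val (t : ℝ) : weilThetaPhi t ≤ weilThetaPhi 0 := by
  rcases eq_or_ne t 0 with rfl | h0
  · exact le_rfl
  · exact (weilThetaPhi_lt_weilThetaPhi_zero h0).le

/-! ## The probe is a window test on `[-(a+η), a+η]` -/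

section Probe

variable {a η : ℝ}

theorem probe_eq_sub (a η : ℝ) :
    probe a η = fun t => ((weilThetaPhi t : ℝ) : ℂ) - leak a η t := by
  funext t
  simp only [probe, leak]
  push_cast
  ring

theorem isWeilTest_probe (hη : 0 < η) : IsWeilTest (probe a η) := by
  constructor
  · have h1 : ContDiff ℝ (⊤ : ℕ∞) (fun t : ℝ => ((cutoffFn a η t : ℝ) : ℂ)) :=
      ofRealCLM.contDiff.comp contDiff_cutoffFn
    have h2 : probe a η = fun t => ((weilThetaPhi t : ℝ) : ℂ) * ((cutoffFn a η t : ℝ) : ℂ) := by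
      funext t; simp [probe]
    rw [h2]
    exact contDiff_ofReal_weilThetaPhi.mul h1
  · refine HasCompactSupport.of_support_subset_isCompact (isCompact_Icc (a := -(a + η)) (b := a + η))
      fun t ht => ?_
    by_contra h
    apply ht
    have : cutoffFn a η t = 0 :=
      cutoffFn_eq_zero_of_not_mem hη fun h' => h (Ioo_subset_Icc_self h')
    simp [probe, this]

theorem tsupport_probe_subset (hη : 0 < η) : tsupport (probe a η) ⊆ Icc (-(a + η)) (a + η) := by
  refine closure_minimal (fun t ht => ?_) isClosed_Icc
  by_contra h
  apply ht
  have : cutoffFn a η t = 0 :=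
    cutoffFn_eq_zero_of_not_mem hη fun h' => h (Ioo_subset_Icc_self h')
  simp [probe, this]

theorem norm_probe_le (t : ℝ) : ‖probe a η t‖ ≤ weilThetaPhi 0 := by
  rw [probe, Complex.norm_real, Real.norm_eq_abs, abs_mul, abs_of_pos (weilThetaPhi_pos t),
    abs_of_nonneg (cutoffFn_nonneg t)]
  exact (mul_le_of_le_one_right (weilThetaPhi_pos t).le (cutoffFn_le_one t)).trans
    (weilThetaPhi_le_zero_val t)

theorem probe_of_mem (hη : 0 < η) {t : ℝ} (ht : t ∈ Icc (-a) a) :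
    probe a η t = ((weilThetaPhi t : ℝ) : ℂ) := by
  simp [probe, cutoffFn_eq_one hη ht]

end Probe

/-! ## Small measure-theoretic facts -/

/-- Convolution on the left is insensitive to a.e. modification. -/
theorem weilConv_congr_ae_left {u v : ℝ → ℂ} (h : u =ᵐ[volume] v) (k : ℝ → ℂ) :
    weilConv u k = weilConv v k := by
  funext x
  rw [weilConv_apply, weilConv_apply]
  exact integral_congr_ae (h.mono fun s hs => by simp only [hs])

/-! ## Cauchy–Schwarz at a window -/

/-- **Cauchy–Schwarz for the shifted form at the window `b`**: for tests `f, h` supported in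
`[-b, b]`, `Re W(f ⋆ h̃) - √q_b(f) √q_b(h) ≤ ε(b) Re⟨f, h⟩`, `q_b(φ) = Re Q(φ) - ε(b)‖φ‖²`
(`ConnesVanSuijlekom.abs_polar_le` + hermitian symmetry). -/
theorem re_weilFunctional_sub_sqrt_le {b : ℝ} {f h : ℝ → ℂ} (hf : IsWeilTest f)
    (hfs : tsupport f ⊆ Icc (-b) b) (hh : IsWeilTest h) (hhs : tsupport h ⊆ Icc (-b) b) :
    (weilFunctional (weilConv f (weilReflect h))).re -
        Real.sqrt ((weilQuadratic f).re - weilGroundEnergy b * ∫ x, ‖f x‖ ^ 2) *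
          Real.sqrt ((weilQuadratic h).re - weilGroundEnergy b * ∫ x, ‖h x‖ ^ 2) ≤
      weilGroundEnergy b * (∫ t, f t * conj (h t)).re := by
  set ε := weilGroundEnergy b with hε
  have hcs := ConnesVanSuijlekom.abs_polar_le hf hfs hh hhs
  have e1 := ConnesVanSuijlekom.re_weilQuadratic_add_real_mul hf hh 1
  have e2 := ConnesVanSuijlekom.integral_norm_sq_add_real_mul hf hh 1
  have hone : (f + fun x => ((1 : ℝ) : ℂ) * h x) = f + h := by
    funext x
    simp
  rw [hone] at e1 e2
  have key : ((weilQuadratic (f + h)).re - ε * ∫ x, ‖(f + h) x‖ ^ 2) -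
      ((weilQuadratic f).re - ε * ∫ x, ‖f x‖ ^ 2) -
      ((weilQuadratic h).re - ε * ∫ x, ‖h x‖ ^ 2) =
      2 * ((weilFunctional (weilConv f (weilReflect h))).re - ε * (∫ t, f t * conj (h t)).re) := by
    rw [e1, e2, weilFunctional_weilConv_weilReflect_swap f h]
    simp only [Complex.add_re, Complex.conj_re]
    ring
  rw [key] at hcs
  have h2 := (abs_le.1 hcs).2
  nlinarith [h2, Real.sqrt_nonneg ((weilQuadratic f).re - ε * ∫ x, ‖f x‖ ^ 2),
    Real.sqrt_nonneg ((weilQuadratic h).re - ε * ∫ x, ‖h x‖ ^ 2)]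

/-! ## Barta's inequality at a good window -/

/-- **The floor at a good window.**  If the window `a > 0` carries a ground state `u` with
`Im u = 0`, `Re u ≥ 0` a.e. on `(-a, a)`, then `ε(a) ≥ -e(a)`, `e(a) = 2ϖ_a cosh(a/2)/Φ(a)`. -/
theorem neg_bartaRate_le_weilGroundEnergy {a : ℝ} (ha : 0 < a) {u : ℝ → ℂ}
    (hu : IsWeilGroundState a u)
    (hsign : ∀ᵐ t : ℝ, t ∈ Ioo (-a) a → (u t).im = 0 ∧ 0 ≤ (u t).re) :
    -bartaRate a ≤ weilGroundEnergy a := by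
  obtain ⟨hu2, g, hg, hQ, hL⟩ := id hu
  /- (0) the non-negative real representative `v` of `u` -/
  set v : ℝ → ℝ := (Ioo (-a) a).indicator fun t => max (u t).re 0 with hv
  have hv0 : ∀ t, 0 ≤ v t := fun t => by
    by_cases ht : t ∈ Ioo (-a) a
    · simp only [hv, indicator_of_mem ht]; exact le_max_right _ _
    · simp only [hv, indicator_of_notMem ht]; exact le_rfl
  have hvs' : ∀ t, t ∉ Ioo (-a) a → v t = 0 := fun t ht => by
    simp only [hv, indicator_of_notMem ht]
  have hvs : ∀ t, t ∉ Icc (-a) a → v t = 0 := fun t ht =>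
    hvs' t fun h => ht (Ioo_subset_Icc_self h)
  have hv_le : ∀ t, |v t| ≤ ‖u t‖ := fun t => by
    by_cases ht : t ∈ Ioo (-a) a
    · simp only [hv, indicator_of_mem ht]
      rw [abs_of_nonneg (le_max_right _ _)]
      exact max_le (Complex.re_le_norm _) (norm_nonneg _)
    · simp only [hv, indicator_of_notMem ht, abs_zero]; exact norm_nonneg _
  have hnull : (volume : Measure ℝ) {-a, a} = 0 := (Set.toFinite _).measure_zero volume
  have hae2 := measure_eq_zero_iff_ae_notMem.1 hnull
  have hIoo_of : ∀ t : ℝ, t ∉ ({-a, a} : Set ℝ) → t ∈ Icc (-a) a → t ∈ Ioo (-a) a := by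
    intro t ht hm
    simp only [mem_insert_iff, mem_singleton_iff, not_or] at ht
    exact ⟨lt_of_le_of_ne hm.1 (fun h => ht.1 h.symm), lt_of_le_of_ne hm.2 (fun h => ht.2 h)⟩
  have hae : u =ᵐ[volume] fun t => ((v t : ℝ) : ℂ) := by
    filter_upwards [hsign, hu.ae_eq_zero_of_notMem, hae2] with t h1 h2 h3
    by_cases ht : t ∈ Ioo (-a) a
    · obtain ⟨him, hre⟩ := h1 ht
      simp only [hv, indicator_of_mem ht, max_eq_left hre]
      exact Complex.ext (by simp) (by simp [him])
    · have hm : t ∉ Icc (-a) a := fun hm => ht (hIoo_of t h3 hm)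
      simp only [hv, indicator_of_notMem ht, h2 hm, Complex.ofReal_zero]
  have hv_meas : AEStronglyMeasurable v volume := by
    have h1 : AEStronglyMeasurable (fun t => max (u t).re 0) volume :=
      (Complex.continuous_re.comp_aestronglyMeasurable hu2.1).sup aestronglyMeasurable_const
    exact h1.indicator measurableSet_Ioo
  have hv_int : Integrable v :=
    Integrable.mono' hu.integrable.norm hv_meas (Eventually.of_forall fun t => by
      rw [Real.norm_eq_abs]; exact hv_le t)
  set uc : ℝ → ℂ := fun t => ((v t : ℝ) : ℂ) with huc
  /- the two moments of `v` -/
  set p : ℝ := ∫ t, v t * weilThetaPhi t with hp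
  set c : ℝ := ∫ t, v t * Real.cosh (t / 2) with hc
  have hcosh_le : ∀ t ∈ Icc (-a) a, Real.cosh (t / 2) ≤ Real.cosh (a / 2) := fun t ht => by
    rw [Real.cosh_le_cosh, abs_div, abs_div, abs_two, abs_of_pos ha]
    exact div_le_div_of_nonneg_right (abs_le.2 ⟨ht.1, ht.2⟩) zero_le_two
  have hvΦ_int : Integrable fun t => v t * weilThetaPhi t := by
    refine Integrable.mono' (hv_int.norm.mul_const (weilThetaPhi 0))
      (hv_meas.mul continuous_weilThetaPhi.aestronglyMeasurable)
      (Eventually.of_forall fun t => ?_)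
    rw [Real.norm_eq_abs, abs_mul, Real.norm_eq_abs, abs_of_pos (weilThetaPhi_pos t)]
    exact mul_le_mul_of_nonneg_left (weilThetaPhi_le_zero_val t) (abs_nonneg _)
  have hvc_int : Integrable fun t => v t * Real.cosh (t / 2) := by
    refine Integrable.mono' (hv_int.norm.mul_const (Real.cosh (a / 2)))
      (hv_meas.mul (by fun_prop : Continuous fun t : ℝ => Real.cosh (t / 2)).aestronglyMeasurable)
      (Eventually.of_forall fun t => ?_)
    rw [Real.norm_eq_abs, abs_mul, Real.norm_eq_abs, abs_of_pos (Real.cosh_pos _)]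
    by_cases ht : t ∈ Icc (-a) a
    · exact mul_le_mul_of_nonneg_left (hcosh_le t ht) (abs_nonneg _)
    · rw [hvs t ht, abs_zero, zero_mul, zero_mul]
  -- `p > 0`
  have hp_pos : 0 < p := by
    have hnn : ∀ t, 0 ≤ v t * weilThetaPhi t := fun t => mul_nonneg (hv0 t) (weilThetaPhi_pos t).le
    have hI : 0 ≤ ∫ t, v t * weilThetaPhi t := integral_nonneg fun t => hnn t
    rcases hI.eq_or_lt with hz | hz'
    · exfalso
      have hvΦ0 : (fun t => v t * weilThetaPhi t) =ᵐ[volume] 0 :=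
        (integral_eq_zero_iff_of_nonneg hnn hvΦ_int).1 hz.symm
      have hu0 : ∀ᵐ t : ℝ, u t = 0 := by
        filter_upwards [hvΦ0, hae] with t h0 h1
        simp only [Pi.zero_apply, mul_eq_zero, (weilThetaPhi_pos t).ne', or_false] at h0
        rw [h1, huc]
        simp only [h0, Complex.ofReal_zero]
      have : ∫ t, ‖u t‖ ^ 2 = 0 := by
        rw [← integral_zero (α := ℝ)]
        exact integral_congr_ae (hu0.mono fun t ht => by simp [ht])
      linarith [hu.integral_norm_sq]
    · exact hz'
  -- `Φ(a) c ≤ cosh(a/2) p`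
  have hcp : weilThetaPhi a * c ≤ Real.cosh (a / 2) * p := by
    rw [hc, hp, ← integral_const_mul, ← integral_const_mul]
    refine integral_mono (hvc_int.const_mul _) (hvΦ_int.const_mul _) fun t => ?_
    dsimp only
    by_cases ht : t ∈ Icc (-a) a
    · have h1 : weilThetaPhi a ≤ weilThetaPhi t := weilThetaPhi_le_of_abs_le (abs_le.2 ⟨ht.1, ht.2⟩)
      have h2 := hcosh_le t ht
      calc weilThetaPhi a * (v t * Real.cosh (t / 2))
          = v t * (weilThetaPhi a * Real.cosh (t / 2)) := by ring
        _ ≤ v t * (weilThetaPhi t * Real.cosh (a / 2)) :=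
          mul_le_mul_of_nonneg_left (mul_le_mul h1 h2 (Real.cosh_pos _).le (weilThetaPhi_pos t).le)
            (hv0 t)
        _ = Real.cosh (a / 2) * (v t * weilThetaPhi t) := by ring
    · rw [hvs t ht]; simp
  /- (1) the inequality at the larger window `a + η`, `0 < η ≤ 1` -/
  obtain ⟨C, hC⟩ := stub_cutoffEnergyBound a ha
  set E : ℝ := |weilGroundEnergy a| + |weilGroundEnergy (a + 1)| with hE
  set C' : ℝ := max C 0 + E * (2 * (a + 1) * weilThetaPhi 0 ^ 2) with hC'
  have hE0 : 0 ≤ E := by positivity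
  have hC'0 : 0 ≤ C' := by positivity
  have step : ∀ η : ℝ, 0 < η → η ≤ 1 →
      -(2 * c * polarWeight a) -
          Real.sqrt (weilGroundEnergy a - weilGroundEnergy (a + η)) * Real.sqrt C' ≤
        weilGroundEnergy (a + η) * p := by
    intro η hη hη1
    set b : ℝ := a + η with hb
    have hb0 : 0 < b := by positivity
    set k : ℝ → ℂ := probe a η with hk_def
    set κ : ℝ → ℂ := leak a η with hκ_def
    have hk : IsWeilTest k := isWeilTest_probe hη
    have hks : tsupport k ⊆ Icc (-b) b := tsupport_probe_subset hη
    have hgb : ∀ n, tsupport (g n) ⊆ Icc (-b) b := fun n =>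
      (hg n).2.1.trans (Icc_subset_Icc (by linarith) (by linarith))
    -- the leakage kernel is in the exponential class
    obtain ⟨hκd, hκe⟩ := stub_leakageKernelEnvelope (cutoffFn a η) contDiff_cutoffFn
      (hasCompactSupport_cutoffFn hη)
    -- harmonic splitting, limit, sign
    have hsplit : ∀ n, weilFunctional (weilConv (g n) (weilReflect k)) =
        -weilFunctional (weilConv (g n) (weilReflect κ)) := fun n => by
      rw [hk_def, probe_eq_sub a η]
      exact stub_harmonicSplit (g n) κ (hg n).1 hκd hκe
    have hlimW : Tendsto (fun n => weilFunctional (weilConv (g n) (weilReflect κ))) atTop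
        (𝓝 (weilFunctional (weilConv u (weilReflect κ)))) :=
      stub_leakageTendsto a u g κ hu hg hL hκd hκe
    have hWu : weilFunctional (weilConv u (weilReflect κ)) =
        weilFunctional (weilConv uc (weilReflect κ)) := by
      rw [weilConv_congr_ae_left hae]
    have hsignW : (weilFunctional (weilConv uc (weilReflect κ))).re ≤ 2 * c * polarWeight a :=
      stub_leakageSign a v (cutoffFn a η) ha hv_int hv0 hvs (fun t ht => cutoffFn_eq_one hη ht)
        (fun t => ⟨cutoffFn_nonneg t, cutoffFn_le_one t⟩) cutoffFn_neg hκd hκe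
    -- the pairing `⟨gₙ, k⟩ → ⟨u, k⟩ = p`
    have hlimP : Tendsto (fun n => ∫ t, g n t * conj (k t)) atTop (𝓝 (∫ t, u t * conj (k t))) :=
      ConnesVanSuijlekom.tendsto_integral_mul_conj_left (ConnesVanSuijlekom.isWeilTest_memLp hk) hu2
        (fun n => ConnesVanSuijlekom.isWeilTest_memLp (hg n).1) hL
    have hPu : (∫ t, u t * conj (k t)).re = p := by
      have h1 : ∫ t, u t * conj (k t) = ∫ t, ((v t * weilThetaPhi t : ℝ) : ℂ) := by
        refine integral_congr_ae (hae.mono fun t ht => ?_)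
        simp only [ht, huc]
        by_cases hm : t ∈ Icc (-a) a
        · rw [hk_def, probe_of_mem hη hm, Complex.conj_ofReal]; push_cast; ring
        · rw [hvs t hm]; simp
      rw [h1, integral_complex_ofReal, Complex.ofReal_re]
    -- `q_b(gₙ) → ε(a) - ε(b)`
    have hlimQ : Tendsto (fun n => Real.sqrt ((weilQuadratic (g n)).re -
        weilGroundEnergy b * ∫ x, ‖g n x‖ ^ 2)) atTop
        (𝓝 (Real.sqrt (weilGroundEnergy a - weilGroundEnergy b))) := by
      refine ((hQ.sub_const (weilGroundEnergy b)).sqrt).congr fun n => ?_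
      rw [(hg n).2.2, mul_one]
    -- `q_b(k) ≤ C'`
    have hqk : (weilQuadratic k).re - weilGroundEnergy b * ∫ x, ‖k x‖ ^ 2 ≤ C' := by
      have h1 : (weilQuadratic k).re ≤ max C 0 := (hC η hη hη1).trans (le_max_left _ _)
      have hI0 : 0 ≤ ∫ x, ‖k x‖ ^ 2 := integral_nonneg fun _ => by positivity
      have hI : ∫ x, ‖k x‖ ^ 2 ≤ 2 * (a + 1) * weilThetaPhi 0 ^ 2 := by
        have hzero : ∀ x, x ∉ Icc (-b) b → ‖k x‖ ^ 2 = 0 := fun x hx => by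
          rw [image_eq_zero_of_notMem_tsupport fun h' => hx (hks h'), norm_zero]; ring
        rw [← setIntegral_eq_integral_of_forall_compl_eq_zero (s := Icc (-b) b)
          (fun x hx => hzero x hx)]
        have hbd : ∀ x ∈ Icc (-b) b, ‖‖k x‖ ^ 2‖ ≤ weilThetaPhi 0 ^ 2 := fun x _ => by
          rw [Real.norm_eq_abs, abs_of_nonneg (by positivity)]
          exact pow_le_pow_left₀ (norm_nonneg _) (norm_probe_le x) 2
        have h2 := norm_setIntegral_le_of_norm_le_const (μ := (volume : Measure ℝ))
          (measure_Icc_lt_top (a := -b) (b := b)) hbd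
        rw [Real.volume_real_Icc_of_le (by linarith), show b - -b = 2 * b by ring] at h2
        have h3 : ∫ x in Icc (-b) b, ‖k x‖ ^ 2 ≤ weilThetaPhi 0 ^ 2 * (2 * b) :=
          (le_abs_self _).trans (by simpa [Real.norm_eq_abs] using h2)
        have h4 : weilThetaPhi 0 ^ 2 * (2 * b) ≤ 2 * (a + 1) * weilThetaPhi 0 ^ 2 := by
          have : b ≤ a + 1 := by linarith
          nlinarith [sq_nonneg (weilThetaPhi 0)]
        exact h3.trans h4
      have hεb : |weilGroundEnergy b| ≤ E := by
        have hlo : weilGroundEnergy (a + 1) ≤ weilGroundEnergy b :=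
          weilGroundEnergy_antitoneOn hb0 (show (0 : ℝ) < a + 1 by positivity) (by linarith)
        have hhi : weilGroundEnergy b ≤ weilGroundEnergy a :=
          weilGroundEnergy_antitoneOn ha hb0 (by linarith)
        rw [hE, abs_le]
        constructor
        · linarith [neg_abs_le (weilGroundEnergy (a + 1)), abs_nonneg (weilGroundEnergy a)]
        · linarith [le_abs_self (weilGroundEnergy a), abs_nonneg (weilGroundEnergy (a + 1))]
      have h5 : -(weilGroundEnergy b * ∫ x, ‖k x‖ ^ 2) ≤ E * (2 * (a + 1) * weilThetaPhi 0 ^ 2) :=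
        calc -(weilGroundEnergy b * ∫ x, ‖k x‖ ^ 2) ≤ |weilGroundEnergy b| * ∫ x, ‖k x‖ ^ 2 := by
              rw [← neg_mul]
              exact mul_le_mul_of_nonneg_right (neg_le_abs _) hI0
          _ ≤ E * (2 * (a + 1) * weilThetaPhi 0 ^ 2) := mul_le_mul hεb hI hI0 hE0
      rw [hC']
      linarith
    -- per-`n` inequality
    have hn : ∀ n, (-(weilFunctional (weilConv (g n) (weilReflect κ)))).re -
        Real.sqrt ((weilQuadratic (g n)).re - weilGroundEnergy b * ∫ x, ‖g n x‖ ^ 2) *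
          Real.sqrt C' ≤
        weilGroundEnergy b * (∫ t, g n t * conj (k t)).re := by
      intro n
      have h1 := re_weilFunctional_sub_sqrt_le (hg n).1 (hgb n) hk hks
      rw [hsplit n] at h1
      have h2 : Real.sqrt ((weilQuadratic (g n)).re - weilGroundEnergy b * ∫ x, ‖g n x‖ ^ 2) *
          Real.sqrt ((weilQuadratic k).re - weilGroundEnergy b * ∫ x, ‖k x‖ ^ 2) ≤
          Real.sqrt ((weilQuadratic (g n)).re - weilGroundEnergy b * ∫ x, ‖g n x‖ ^ 2) *
            Real.sqrt C' :=
        mul_le_mul_of_nonneg_left (Real.sqrt_le_sqrt hqk) (Real.sqrt_nonneg _)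
      linarith
    -- pass to the limit `n → ∞`
    have hlim_lhs : Tendsto (fun n => (-(weilFunctional (weilConv (g n) (weilReflect κ)))).re -
        Real.sqrt ((weilQuadratic (g n)).re - weilGroundEnergy b * ∫ x, ‖g n x‖ ^ 2) *
          Real.sqrt C') atTop
        (𝓝 ((-(weilFunctional (weilConv u (weilReflect κ)))).re -
          Real.sqrt (weilGroundEnergy a - weilGroundEnergy b) * Real.sqrt C')) :=
      ((Complex.continuous_re.tendsto _).comp hlimW.neg).sub (hlimQ.mul_const _)
    have hlim_rhs : Tendsto (fun n => weilGroundEnergy b * (∫ t, g n t * conj (k t)).re) atTop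
        (𝓝 (weilGroundEnergy b * p)) := by
      rw [← hPu]
      exact ((Complex.continuous_re.tendsto _).comp hlimP).const_mul _
    have hlim := le_of_tendsto_of_tendsto' hlim_lhs hlim_rhs hn
    have h6 : (weilFunctional (weilConv u (weilReflect κ))).re ≤ 2 * c * polarWeight a := by
      rw [hWu]; exact hsignW
    have h7 : (-(weilFunctional (weilConv u (weilReflect κ)))).re =
        -(weilFunctional (weilConv u (weilReflect κ))).re := Complex.neg_re _
    linarith
  /- (2) `η → 0⁺` through the continuity of `ε` -/
  have hη : ∀ m : ℕ, 0 < 1 / ((m : ℝ) + 1) ∧ 1 / ((m : ℝ) + 1) ≤ 1 := fun m =>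
    ⟨by positivity, by rw [div_le_one (by positivity)]; linarith [(Nat.cast_nonneg m : (0 : ℝ) ≤ m)]⟩
  have hten : Tendsto (fun m : ℕ => a + 1 / ((m : ℝ) + 1)) atTop (𝓝 a) := by
    have h := (tendsto_const_nhds (x := a) (f := (atTop : Filter ℕ))).add
      tendsto_one_div_add_atTop_nhds_zero_nat
    rw [add_zero] at h
    exact h
  have hεlim : Tendsto (fun m : ℕ => weilGroundEnergy (a + 1 / ((m : ℝ) + 1))) atTop
      (𝓝 (weilGroundEnergy a)) :=
    (continuousAt_weilGroundEnergy ha).tendsto.comp hten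
  have hΔlim : Tendsto (fun m : ℕ =>
      Real.sqrt (weilGroundEnergy a - weilGroundEnergy (a + 1 / ((m : ℝ) + 1))) * Real.sqrt C')
      atTop (𝓝 0) := by
    have h := (((tendsto_const_nhds (x := weilGroundEnergy a)).sub hεlim).sqrt).mul_const
      (Real.sqrt C')
    simpa using h
  have hfinal : -(2 * c * polarWeight a) ≤ weilGroundEnergy a * p := by
    refine le_of_tendsto_of_tendsto' (b := atTop)
      (f := fun m : ℕ => -(2 * c * polarWeight a) -
        Real.sqrt (weilGroundEnergy a - weilGroundEnergy (a + 1 / ((m : ℝ) + 1))) * Real.sqrt C')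
      (g := fun m : ℕ => weilGroundEnergy (a + 1 / ((m : ℝ) + 1)) * p) ?_ (hεlim.mul_const p)
      fun m => step _ (hη m).1 (hη m).2
    simpa using tendsto_const_nhds.sub hΔlim
  /- (3) algebra: `ε p ≥ -2cϖ ≥ -e(a) p` -/
  have hΦa := weilThetaPhi_pos a
  have hϖ := polarWeight_nonneg a
  have h1 : c ≤ Real.cosh (a / 2) * p / weilThetaPhi a := by
    rw [le_div_iff₀ hΦa]; linarith
  have h2 : 2 * c * polarWeight a ≤ bartaRate a * p := by
    have : 2 * c * polarWeight a ≤ 2 * (Real.cosh (a / 2) * p / weilThetaPhi a) * polarWeight a :=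
      by gcongr
    refine this.trans (le_of_eq ?_)
    unfold bartaRate
    field_simp
  have h3 : -bartaRate a * p ≤ weilGroundEnergy a * p := by linarith
  exact le_of_mul_le_mul_right h3 hp_pos

/-! ## The sphere of the window (refuter's `GroundBartaFloorLogic`, copied) -/

/-- `ε(a) ≤ Re Q(h)` on the normalised sphere of the window. -/
theorem weilGroundEnergy_le_of_sphere {a : ℝ} {h : ℝ → ℂ} (hh : IsWeilTest h)
    (hsupp : tsupport h ⊆ Icc (-a) a) (hnorm : ∫ t, ‖h t‖ ^ 2 = (1 : ℝ)) :
    weilGroundEnergy a ≤ (weilQuadratic h).re :=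
  csInf_le (bddBelow_weilQuadratic_sphere_holds a) ⟨h, hh, hsupp, hnorm, rfl⟩

/-- The junk-free "eventually below every competitor" clause of the crux implies convergence of
the energies to `ε(a)`. -/
theorem tendsto_weilGroundEnergy_of_forall_eventually_le {a : ℝ} {g : ℕ → ℝ → ℂ}
    (hg : ∀ n, IsWeilTest (g n) ∧ tsupport (g n) ⊆ Icc (-a) a ∧ ∫ t, ‖g n t‖ ^ 2 = (1 : ℝ))
    (H : ∀ h : ℝ → ℂ, IsWeilTest h → tsupport h ⊆ Icc (-a) a → ∫ t, ‖h t‖ ^ 2 = (1 : ℝ) →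
        ∀ δ : ℝ, 0 < δ → ∀ᶠ n in atTop, (weilQuadratic (g n)).re ≤ (weilQuadratic h).re + δ) :
    Tendsto (fun n ↦ (weilQuadratic (g n)).re) atTop (𝓝 (weilGroundEnergy a)) := by
  set S : Set ℝ := {x : ℝ | ∃ g : ℝ → ℂ, IsWeilTest g ∧ tsupport g ⊆ Icc (-a) a ∧
    ∫ t : ℝ, ‖g t‖ ^ 2 = 1 ∧ x = (weilQuadratic g).re} with hSdef
  have hS : BddBelow S := bddBelow_weilQuadratic_sphere_holds a
  have hε : weilGroundEnergy a = sInf S := rfl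
  have hmem : ∀ n, (weilQuadratic (g n)).re ∈ S := fun n ↦
    ⟨g n, (hg n).1, (hg n).2.1, (hg n).2.2, rfl⟩
  have hne : S.Nonempty := ⟨_, hmem 0⟩
  have hlow : ∀ n, weilGroundEnergy a ≤ (weilQuadratic (g n)).re := fun n ↦
    hε ▸ csInf_le hS (hmem n)
  rw [tendsto_order]
  refine ⟨fun x hx ↦ Eventually.of_forall fun n ↦ hx.trans_le (hlow n), fun x hx ↦ ?_⟩
  have hδ : 0 < (x - weilGroundEnergy a) / 2 := by linarith
  have hlt : sInf S < weilGroundEnergy a + (x - weilGroundEnergy a) / 2 := by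
    rw [← hε]; linarith
  obtain ⟨y, ⟨h, hh, hsupp, hnorm, rfl⟩, hy⟩ := exists_lt_of_csInf_lt hne hlt
  filter_upwards [H h hh hsupp hnorm _ hδ] with n hn
  linarith

/-! ## The crux -/

/-- **The ground Barta floor** (crux `GroundBarta.GroundBartaFloor`, stmt-RiemannHypothesis-18389):
with `e = bartaRate` (`→ 0`, stub D) and `a₀ = 1`, at every window `a ≥ 1` carrying a one-signed
bottom state every normalised window test has `Re Q(h) ≥ ε(a) ≥ -e(a)`. -/
theorem GroundBartaFloor_of :
    Summit.RiemannHypothesis.RiemannHypothesis.Theses.GroundBarta.GroundBartaFloor := by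
  rw [show Summit.RiemannHypothesis.RiemannHypothesis.Theses.GroundBarta.GroundBartaFloor ↔
      (∃ e : ℝ → ℝ, Tendsto e atTop (nhds 0) ∧ ∃ a₀ : ℝ, ∀ a : ℝ, a₀ ≤ a →
        (∃ u : ℝ → ℂ, (MemLp u 2 ∧ ∃ g : ℕ → ℝ → ℂ,
            (∀ n, IsWeilTest (g n) ∧ tsupport (g n) ⊆ Icc (-a) a ∧ ∫ t, ‖g n t‖ ^ 2 = (1 : ℝ)) ∧
            (∀ h : ℝ → ℂ, IsWeilTest h → tsupport h ⊆ Icc (-a) a → ∫ t, ‖h t‖ ^ 2 = (1 : ℝ) →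
              ∀ δ : ℝ, 0 < δ → ∀ᶠ n in atTop, (weilQuadratic (g n)).re ≤ (weilQuadratic h).re + δ) ∧
            Tendsto (fun n => ∫ t, ‖g n t - u t‖ ^ 2) atTop (nhds 0)) ∧
          (∀ᵐ t : ℝ, t ∈ Ioo (-a) a → (u t).im = 0 ∧ 0 ≤ (u t).re)) →
        ∀ h : ℝ → ℂ, IsWeilTest h → tsupport h ⊆ Icc (-a) a →
          ∫ t, ‖h t‖ ^ 2 = (1 : ℝ) → -e a ≤ (weilQuadratic h).re) from Iff.rfl]
  refine ⟨bartaRate, stub_bartaRateDecay, 1, fun a ha hgood h hh hs hnorm => ?_⟩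
  obtain ⟨u, ⟨hu2, g, hg, hmin, hL⟩, hsign⟩ := hgood
  have ha0 : 0 < a := one_pos.trans_le ha
  have hu' : IsWeilGroundState a u :=
    ⟨hu2, g, hg, tendsto_weilGroundEnergy_of_forall_eventually_le hg hmin, hL⟩
  exact (neg_bartaRate_le_weilGroundEnergy ha0 hu' hsign).trans
    (weilGroundEnergy_le_of_sphere hh hs hnorm)

end Summit.RiemannHypothesis.RiemannHypothesis.Cruxes.GroundBartaFloor.OuterCutoff

end
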